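import Literature.NumberTheory.Rogawski1990.RankOneUnstableUnitParity                 -- ★ p842596 FILE A (p08 g14): `rankOne_lhs_indicator_one_eq_of_eigenframe`, `finHeckeValue_one`
import Literature.NumberTheory.Rogawski1990.RankOneUnstableNormOneSequence            -- FILE A′ (p08 g14): `exists_normOne_seq`
import Literature.NumberTheory.Rogawski1990.RankOneUnstableTransferNonsplit            -- ★ the UNGUARDED letter `RankOneUnstableTransferNonsplit` (ED. 2 text; ED. 3 keeps it as the negative edge)
import Literature.NumberTheory.Rogawski1990.LocalEndoscopicTorusTransportFrameCM       -- ★ p842138 A-p19: frame algebra re-exports (`conj_diagonal_mem_unitaryGroupOfForm_of_gram`, `continuous_mk''_…`, `smul_one_mem_unitaryGroupOfForm`)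
import Literature.NumberTheory.Automorphic.UnitaryEllipticCentralizerCompactNonsplit   -- ★ `compactSpace_centralizer_of_eigenframe_of_smul_eq`
import Literature.NumberTheory.Automorphic.OrbitalMeasureCanonicalExistsCM             -- ★ `exists_isCanonical_H_local`
import Literature.NumberTheory.Automorphic.LocalOrbitalMeasureRegular                  -- ★ `isMulRightInvariant_localEndoscopic`
import Literature.NumberTheory.Automorphic.UnitaryResiduallyRegularOrbitalIntegral     -- ★ `isCompact_isOpen_cmLocalIntegralLevel_prod`
import Literature.NumberTheory.Rogawski1990.FinExplicitTransferFactorTorusDockSplit    -- ★ `finCharpolyTwo_eq_of_frame`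
import Literature.NumberTheory.Rogawski1990.LocalNormFibreNonsplit                     -- ★ `charpoly_endoEmbLocal`
import Literature.NumberTheory.Rogawski1990.EndoscopicCentralizerIso                    -- ★ `isUnit_two_localRing`
import HarnessLib

/-!
# The UNGUARDED rank-one unstable letter is FALSE: every CM field with one unramified non-split place refutes `RankOneUnstableTransferNonsplit`
# (Rogawski 1990 Lemma 4.9.3 needs `μ|𝕀_F = ω_{E∕F}`; Labesse–Langlands 1979 §2)

Topic `NumberTheory/Rogawski1990`; namespace `Literature.NumberTheory.Rogawski1990`.  THEOREMS ONLY (no definition, no instance, no notation, no named fact,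
no `sorry`).  Cell `pub/hodgecm-mathlib` (D-0151), crux H413 = stmt-HodgeConjecture-24833, line «N6nsGerm»; LEAD F0P3a-plan (g10) WORD T9-1 (1) «NEGATIVE LEMMA →
p08 (g14)» (finding F0P3-p02 (g12) 08:05:28Z, computation B-p10 (g25) b80aed6c §2 v2, lineage «=» F0P3-p01 (g13) 08:07:09Z); seat F0P3a-p08 (g14); FILE B of three
(A = ★ `RankOneUnstableUnitParity`; C = `Summits/…/Theorems/F0P3aR1lcObstruction.lean`, the concrete place).  HONEST LABEL: HC_CM is proved only modulo the 2 remaining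
named inputs (hLiu418, h413) until rung 0 closes; this file is unconditional and REFUTES a mis-typed letter (the μ-guarded `RankOneUnstableTransferNonsplitCM` is
untouched: the witness `μ = 1` violates `μ|𝕀_F = ω`).

THE MATHEMATICS.  `v` unramified non-split, `w ∣ v`.  Instantiate the letter at `μ := 1`, `Reg := IsLocalGRegular`, `ν := haarMeasure K_H`, the canonical family (★
`exists_isCanonical_H_local`), `f := 𝟙_{K_H}`, and the type-(1) torus through the frame `Q = [[1,1],[1,−1]]` (`ᵗσ̄QΦ₂Q = diag(2,−2)`): `t(e) := (Q·diag(1,e)·Q⁻¹, u₁)`,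
`e ∈ L_w¹`.  ★ `exists_normOne_seq` gives `u_N ∈ L_w¹` with `|1 − u_N| = |ϖ|^N`, `u_N → 1`; `t(u_N) → t(1)` inside `C = Z(t(u₂))`, each `t(u_N)` (`N ≥ 2`) is `G`-regular with compact
centraliser, and by FILE A the letter's left side at `t(u_N)` is `r_N·(−1)^e·(−1)^N q^N` (`r_N > 0`, `e` FIXED BY `Q`).  `f^C` is locally constant at `t(1)`, so these
values agree for large `N`: `(r_N + q·r_{N+1})·(±q^N) = 0` — impossible.

* **`not_rankOneUnstableTransferNonsplit_of_isUnramifiedIn`** — `(L) (v) (w) (hw : c • w = w) (hunr) : ¬ RankOneUnstableTransferNonsplit`.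

## References
* [Rogawski1990] J. D. Rogawski, *Automorphic Representations of Unitary Groups in Three Variables*, Ann. of Math. Stud. 123 (1990): §4.9 Lemma 4.9.3 (4.9.2) p. 56.
* [LabesseLanglands1979] J.-P. Labesse, R. P. Langlands, *L-indistinguishability for SL(2)*, Canad. J. Math. 31 (1979): §2.
* [Flicker1998UnitaryFL] Y. Z. Flicker, *Elementary proof of the fundamental lemma for a unitary group*, Canad. J. Math. 50 (1998): §6 p. 95.
-/

set_option autoImplicit false

noncomputable section

open MeasureTheory Measure NumberField IsDedekindDomain Matrix Finset Filter Topology ValuativeRel Polynomial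
open scoped ValuativeRel Matrix MatrixGroups

namespace Literature.NumberTheory.Rogawski1990

open Literature.NumberTheory.Automorphic Literature.NumberTheory.Automorphic.UnitaryGroup Literature.NumberTheory.GaloisRepresentations

variable (L : Type) [Field L] [NumberField L] [IsCMField L] (v : HeightOneSpectrum (𝓞 ↥(maximalRealSubfield L)))
  (w : PlacesOver L v) (hw : IsCMField.complexConj L • w.1 = w.1)


/-! ## The refutation at an unramified non-split place -/

section Refutation

omit [IsCMField L] in
/-- `2 ≤ q_v`. [cite: NeukirchANT1999, Ch. I §3] -/
private theorem two_le_natCard_quotient'' : 2 ≤ Nat.card (𝓞 ↥(maximalRealSubfield L) ⧸ v.asIdeal) := by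
  classical
  haveI : Finite (𝓞 ↥(maximalRealSubfield L) ⧸ v.asIdeal) := Ideal.finiteQuotientOfFreeOfNeBot v.asIdeal v.ne_bot
  haveI : Nontrivial (𝓞 ↥(maximalRealSubfield L) ⧸ v.asIdeal) := Ideal.Quotient.nontrivial_iff.2 v.isPrime.ne_top
  exact Finite.one_lt_card

/-- `![a, b]` is injective when `a ≠ b`. [folklore] -/
private theorem injective_vecCons_pair {α : Type*} {a b : α} (h : a ≠ b) : Function.Injective ![a, b] := by
  intro i j hij
  fin_cases i <;> fin_cases j
  · rfl
  · exact absurd hij h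
  · exact absurd hij.symm h
  · rfl

set_option maxHeartbeats 400000 in
include hw in
/-- **THE UNGUARDED RANK-ONE UNSTABLE LETTER IS FALSE.**  For every CM field `L` and every finite place `v` of `L⁺` UNRAMIFIED in `L` with a place `w` above it fixed by
complex conjugation (so `v` is non-split), `RankOneUnstableTransferNonsplit` fails: instantiate it at `μ := 1`, `Reg := IsLocalGRegular`, `ν := haarMeasure K_H`, the canonical
family, `f := 𝟙_{K_H}` and the type-(1) torus through the frame `Q = [[1,1],[1,−1]]`; along the norm-one sequence of §1 the left side of (4.9.2) is `r_N·(−1)^e·(−1)^N q^N`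
with `r_N > 0` (★ FILE A), while the letter's `f^C` is locally constant at the limit point `(1₂, u₁)` — a sign clash.  See the module docstring.
[cite: Rogawski1990, §4.9 Lemma 4.9.3 (4.9.2) p. 56] [cite: LabesseLanglands1979, §2] [cite: Flicker1998UnitaryFL, §6 p. 95] -/
theorem not_rankOneUnstableTransferNonsplit_of_isUnramifiedIn (hunr : Algebra.IsUnramifiedIn (𝓞 L) v.asIdeal) :
    ¬ RankOneUnstableTransferNonsplit := by
  intro hR
  classical
  have hc1 : IsCMField.complexConj L ≠ 1 := IsCMField.complexConj_ne_one L
  haveI : Algebra.IsQuadraticExtension ↥(maximalRealSubfield L) L := IsCMField.isQuadraticExtension L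
  have hv : Subsingleton (PlacesOver L v) := PlacesOver.subsingleton_of_smul_eq (IsCMField.complexConj L) hc1 w hw
  letI : Unique (PlacesOver L v) := uniqueOfSubsingleton w
  -- §0 the data of the place: `σ = c ⊗ 1` on `E_v = ∏_{w ∣ v} L_w = L_w`
  have hσc : Continuous (conjLocal L (IsCMField.complexConj L) v) := continuous_conjLocal L (IsCMField.complexConj L) v
  have hσw : ∀ x : LocalRing L v, conjLocal L (IsCMField.complexConj L) v x w = galAdicCompletionMap (L := L) (IsCMField.complexConj L) hw (x w) :=
    fun x => conjLocal_apply_eq_galAdicCompletionMap L v w hw x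
  have heqw : ∀ x y : LocalRing L v, x = y ↔ x w = y w := fun x y => LocalRing.eq_iff_apply_eq (IsCMField.complexConj L) hc1 w hw x y
  have hunit : ∀ x : LocalRing L v, x w ≠ 0 → IsUnit x := fun x hx =>
    isUnit_localRing_of_ne_zero_of_subsingleton L v hv fun h0 => hx (by rw [h0]; rfl)
  -- §1 the norm-one sequence on `L_w`, lifted to `E_v`
  obtain ⟨u, hu1, huv, hut⟩ := exists_normOne_seq L v w hw hunr
  let π : LocalRing L v ≃+* w.1.adicCompletion L := RingEquiv.piUnique fun w' : PlacesOver L v => w'.1.adicCompletion L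
  let uE : ℕ → LocalRing L v := fun N => π.symm (u N)
  have huEw : ∀ N, uE N w = u N := fun N => π.apply_symm_apply (u N)
  have huE1 : ∀ N, conjLocal L (IsCMField.complexConj L) v (uE N) * uE N = 1 := fun N => by
    rw [heqw, Pi.mul_apply, hσw, huEw, Pi.one_apply]; exact hu1 N
  have hϖ0 : (toPlace v w (HeckeCharacter.uniformizer ↥(maximalRealSubfield L) v : v.adicCompletion ↥(maximalRealSubfield L))) ≠ 0 :=
    toPlace_uniformizer_ne_zero L v w hunr
  have hϖv : Valued.v (toPlace v w (HeckeCharacter.uniformizer ↥(maximalRealSubfield L) v : v.adicCompletion ↥(maximalRealSubfield L))) = WithZero.exp (-1 : ℤ) :=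
    Liu2021.LemD1IndexedNonVacuityInertCofinite.valued_toPlace_uniformizer_of_isUnramifiedIn L v hunr w
  -- `1 − u_N ≠ 0` (`N ≥ 1`) and `u_N ≠ u_M` for `1 ≤ M < N` (their `1 − ·` have different valuations)
  have hu_ne_one : ∀ N, 1 ≤ N → 1 - u N ≠ 0 := fun N hN h0 => by
    have h := huv N hN
    rw [h0, map_zero, Valuation.map_pow] at h
    exact pow_ne_zero N ((Valuation.ne_zero_iff _).2 hϖ0) h.symm
  have hu_ne : ∀ M N, 1 ≤ M → M < N → u N - u M ≠ 0 := fun M N hM hMN h0 => by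
    have hMN' : u N = u M := sub_eq_zero.1 h0
    have h := huv N (le_of_lt (lt_of_le_of_lt hM hMN))
    rw [hMN', huv M hM, Valuation.map_pow, Valuation.map_pow, hϖv, ← WithZero.exp_nsmul, ← WithZero.exp_nsmul] at h
    have h' := WithZero.exp_injective h
    simp only [nsmul_eq_mul, mul_neg, mul_one, neg_inj, Nat.cast_inj] at h'
    omega
  -- §2 measures: Borel σ-algebras, `ν := haarMeasure K_H` (`ν(K_H) = 1`), the canonical family, `Reg := IsLocalGRegular`, `f := 𝟙_{K_H}`
  letI iH : MeasurableSpace ((cmDatum L 2 (Matrix.of fun i j : Fin 2 => if i.val + j.val + 1 = 2 then (1 : L) else 0)).Local v ×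
      (cmDatum L 1 (Matrix.of fun i j : Fin 1 => if i.val + j.val + 1 = 1 then (1 : L) else 0)).Local v) := borel _
  haveI : BorelSpace ((cmDatum L 2 (Matrix.of fun i j : Fin 2 => if i.val + j.val + 1 = 2 then (1 : L) else 0)).Local v ×
      (cmDatum L 1 (Matrix.of fun i j : Fin 1 => if i.val + j.val + 1 = 1 then (1 : L) else 0)).Local v) := ⟨rfl⟩
  letI iZ : ∀ a : (cmDatum L 2 (Matrix.of fun i j : Fin 2 => if i.val + j.val + 1 = 2 then (1 : L) else 0)).Local v ×
      (cmDatum L 1 (Matrix.of fun i j : Fin 1 => if i.val + j.val + 1 = 1 then (1 : L) else 0)).Local v,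
      MeasurableSpace (((cmDatum L 2 (Matrix.of fun i j : Fin 2 => if i.val + j.val + 1 = 2 then (1 : L) else 0)).Local v ×
        (cmDatum L 1 (Matrix.of fun i j : Fin 1 => if i.val + j.val + 1 = 1 then (1 : L) else 0)).Local v) ⧸
        Subgroup.centralizer ({a} : Set ((cmDatum L 2 (Matrix.of fun i j : Fin 2 => if i.val + j.val + 1 = 2 then (1 : L) else 0)).Local v ×
          (cmDatum L 1 (Matrix.of fun i j : Fin 1 => if i.val + j.val + 1 = 1 then (1 : L) else 0)).Local v))) := fun _ => borel _
  haveI : ∀ a : (cmDatum L 2 (Matrix.of fun i j : Fin 2 => if i.val + j.val + 1 = 2 then (1 : L) else 0)).Local v ×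
      (cmDatum L 1 (Matrix.of fun i j : Fin 1 => if i.val + j.val + 1 = 1 then (1 : L) else 0)).Local v,
      BorelSpace (((cmDatum L 2 (Matrix.of fun i j : Fin 2 => if i.val + j.val + 1 = 2 then (1 : L) else 0)).Local v ×
        (cmDatum L 1 (Matrix.of fun i j : Fin 1 => if i.val + j.val + 1 = 1 then (1 : L) else 0)).Local v) ⧸
        Subgroup.centralizer ({a} : Set ((cmDatum L 2 (Matrix.of fun i j : Fin 2 => if i.val + j.val + 1 = 2 then (1 : L) else 0)).Local v ×
          (cmDatum L 1 (Matrix.of fun i j : Fin 1 => if i.val + j.val + 1 = 1 then (1 : L) else 0)).Local v))) := fun _ => ⟨rfl⟩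
  obtain ⟨hKc, hKo⟩ := isCompact_isOpen_cmLocalIntegralLevel_prod L 2 1 (Matrix.of fun i j : Fin 2 => if i.val + j.val + 1 = 2 then (1 : L) else 0)
    (Matrix.of fun i j : Fin 1 => if i.val + j.val + 1 = 1 then (1 : L) else 0) v
  set KH : Subgroup ((cmDatum L 2 (Matrix.of fun i j : Fin 2 => if i.val + j.val + 1 = 2 then (1 : L) else 0)).Local v ×
      (cmDatum L 1 (Matrix.of fun i j : Fin 1 => if i.val + j.val + 1 = 1 then (1 : L) else 0)).Local v) :=
    (cmLocalIntegralLevel L 2 (Matrix.of fun i j : Fin 2 => if i.val + j.val + 1 = 2 then (1 : L) else 0) v).prod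
      (cmLocalIntegralLevel L 1 (Matrix.of fun i j : Fin 1 => if i.val + j.val + 1 = 1 then (1 : L) else 0) v) with hKHdef
  let K₀ : TopologicalSpace.PositiveCompacts ((cmDatum L 2 (Matrix.of fun i j : Fin 2 => if i.val + j.val + 1 = 2 then (1 : L) else 0)).Local v ×
      (cmDatum L 1 (Matrix.of fun i j : Fin 1 => if i.val + j.val + 1 = 1 then (1 : L) else 0)).Local v) :=
    ⟨⟨(KH : Set _), hKc⟩, by rw [hKo.interior_eq]; exact ⟨1, KH.one_mem⟩⟩
  set ν : Measure ((cmDatum L 2 (Matrix.of fun i j : Fin 2 => if i.val + j.val + 1 = 2 then (1 : L) else 0)).Local v ×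
      (cmDatum L 1 (Matrix.of fun i j : Fin 1 => if i.val + j.val + 1 = 1 then (1 : L) else 0)).Local v) := Measure.haarMeasure K₀ with hνdef
  haveI : ν.IsMulRightInvariant := isMulRightInvariant_localEndoscopic L v ν
  have hνK : ν (KH : Set _) = 1 := Measure.haarMeasure_self
  obtain ⟨mH, hmH⟩ := exists_isCanonical_H_local L v ν
  have hReg1 : ∀ γ : (cmDatum L 2 (Matrix.of fun i j : Fin 2 => if i.val + j.val + 1 = 2 then (1 : L) else 0)).Local v ×
      (cmDatum L 1 (Matrix.of fun i j : Fin 1 => if i.val + j.val + 1 = 1 then (1 : L) else 0)).Local v,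
      IsLocalGRegular L v γ → IsRegularElt (γ.1.val : GL (Fin 2) (LocalRing L v)) := fun γ h => (isRegularElt_fst_snd_of_isLocalGRegular L v γ h).1
  have hReg2 : ∀ (γ x : (cmDatum L 2 (Matrix.of fun i j : Fin 2 => if i.val + j.val + 1 = 2 then (1 : L) else 0)).Local v ×
      (cmDatum L 1 (Matrix.of fun i j : Fin 1 => if i.val + j.val + 1 = 1 then (1 : L) else 0)).Local v),
      IsLocalGRegular L v γ → IsLocalGRegular L v (x * γ * x⁻¹) := fun γ x h => isLocalGRegular_of_isConj (isConj_iff.2 ⟨x, rfl⟩) h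
  have hf : IsLocSmooth (((KH : Subgroup _) : Set ((cmDatum L 2 (Matrix.of fun i j : Fin 2 => if i.val + j.val + 1 = 2 then (1 : L) else 0)).Local v ×
      (cmDatum L 1 (Matrix.of fun i j : Fin 1 => if i.val + j.val + 1 = 1 then (1 : L) else 0)).Local v)).indicator fun _ => (1 : ℂ)) :=
    isLocSmooth_indicator_subgroup KH hKo hKc
  -- §3 the frame `Q = [[1,1],[1,−1]]`: Gram matrix `diag(2, −2)`
  obtain ⟨J₂, hJ₂⟩ : ∃ J₂ : Matrix (Fin 2) (Fin 2) (LocalRing L v),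
      J₂ = (adelicForm L 2 (Matrix.of fun i j : Fin 2 => if i.val + j.val + 1 = 2 then (1 : L) else 0)).map (adeleToLocal L v) := ⟨_, rfl⟩
  have hJ₂e : J₂ = !![0, 1; 1, 0] := by
    rw [hJ₂, adelicForm_map_adeleToLocal]
    ext i j : 1; fin_cases i <;> fin_cases j <;> simp [Matrix.of_apply]
  have h2u : IsUnit (2 : LocalRing L v) := isUnit_two_localRing L v
  have hQdet : IsUnit (!![(1 : LocalRing L v), 1; 1, -1]).det := by
    rw [Matrix.det_fin_two_of]
    have h : (1 : LocalRing L v) * -1 - 1 * 1 = -2 := by ring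
    rw [h]; exact h2u.neg
  set Q : GL (Fin 2) (LocalRing L v) := Matrix.GeneralLinearGroup.mk'' _ hQdet with hQdef
  have hQval : Q.val = !![(1 : LocalRing L v), 1; 1, -1] := rfl
  have hQσ : Q.val.map (conjLocal L (IsCMField.complexConj L) v) = Q.val := by
    rw [hQval]; ext i j : 1; fin_cases i <;> fin_cases j <;> simp
  have hG01 : ((Q.val.map (conjLocal L (IsCMField.complexConj L) v))ᵀ * J₂ * Q.val) 0 1 = 0 := by
    rw [hQσ, hQval, hJ₂e]
    simp [Matrix.mul_apply, Fin.sum_univ_two, Matrix.transpose_apply]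
  have hG10 : ((Q.val.map (conjLocal L (IsCMField.complexConj L) v))ᵀ * J₂ * Q.val) 1 0 = 0 := by
    rw [hQσ, hQval, hJ₂e]
    simp [Matrix.mul_apply, Fin.sum_univ_two, Matrix.transpose_apply]
  have hQQ : Q⁻¹.val * Q.val = 1 := by rw [← Units.val_mul, inv_mul_cancel, Units.val_one]
  -- §4 the torus map `e ↦ t(e) := (Q·diag(1,e)·Q⁻¹, u₁)` on the norm-one elements of `E_v`
  have hnorm : ∀ e : {x : LocalRing L v // conjLocal L (IsCMField.complexConj L) v x * x = 1}, ∀ i,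
      conjLocal L (IsCMField.complexConj L) v (![(1 : LocalRing L v), e.1] i) * ![(1 : LocalRing L v), e.1] i = 1 := by
    intro e i; fin_cases i
    · simp
    · exact e.2
  have hdetD : ∀ e : {x : LocalRing L v // conjLocal L (IsCMField.complexConj L) v x * x = 1}, IsUnit (diagonal ![(1 : LocalRing L v), e.1]).det := by
    intro e
    rw [det_diagonal, Fin.prod_univ_two]
    exact isUnit_one.mul (isUnit_iff_exists_inv'.mpr ⟨_, e.2⟩)
  have hγ₁det : IsUnit ((uE 1) • (1 : Matrix (Fin 1) (Fin 1) (LocalRing L v))).det := isUnit_det_smul_one (isUnit_iff_exists_inv'.mpr ⟨_, huE1 1⟩)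
  let γ₁ : (cmDatum L 1 (Matrix.of fun i j : Fin 1 => if i.val + j.val + 1 = 1 then (1 : L) else 0)).Local v :=
    ⟨Matrix.GeneralLinearGroup.mk'' _ hγ₁det, smul_one_mem_unitaryGroupOfForm _ _ (huE1 1) hγ₁det⟩
  let Θ : {x : LocalRing L v // conjLocal L (IsCMField.complexConj L) v x * x = 1} → ((cmDatum L 2 (Matrix.of fun i j : Fin 2 => if i.val + j.val + 1 = 2 then (1 : L) else 0)).Local v ×
      (cmDatum L 1 (Matrix.of fun i j : Fin 1 => if i.val + j.val + 1 = 1 then (1 : L) else 0)).Local v) := fun e =>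
    (⟨Q * Matrix.GeneralLinearGroup.mk'' _ (hdetD e) * Q⁻¹, by
        rw [hJ₂] at hG01 hG10
        exact conj_diagonal_mem_unitaryGroupOfForm_of_gram (conjLocal L (IsCMField.complexConj L) v) _ Q hG01 hG10 _ (hnorm e) (hdetD e)⟩, γ₁)
  have hΘval : ∀ e, ((Θ e).1.val.val : Matrix (Fin 2) (Fin 2) (LocalRing L v)) = Q.val * diagonal ![(1 : LocalRing L v), e.1] * Q⁻¹.val := fun _ => rfl
  have hΘframe : ∀ e, ((Θ e).1.val.val : Matrix (Fin 2) (Fin 2) (LocalRing L v)) * Q.val = Q.val * diagonal ![(1 : LocalRing L v), e.1] := fun e => by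
    rw [hΘval, Matrix.mul_assoc, hQQ, Matrix.mul_one]
  have hΘsnd : ∀ e, finGammaTwo L v (Θ e) = uE 1 := fun _ => by
    change ((uE 1) • (1 : Matrix (Fin 1) (Fin 1) (LocalRing L v))) 0 0 = uE 1
    rw [Matrix.smul_apply, Matrix.one_apply_eq, smul_eq_mul, mul_one]
  have hΘc : Continuous Θ := by
    have hval : Continuous fun e : {x : LocalRing L v // conjLocal L (IsCMField.complexConj L) v x * x = 1} => e.1 := continuous_subtype_val
    refine Continuous.prodMk (Continuous.subtype_mk ?_ _) continuous_const
    exact (continuous_const.mul (continuous_mk''_diagonal_two continuous_const hval continuous_const (hσc.comp hval)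
      (fun _ => one_mul 1) (fun e => by rw [mul_comm]; exact e.2) hdetD)).mul continuous_const
  -- `G`-regularity: eigenvalues `1, e, u₁` pairwise distinct
  have hΘreg : ∀ e : {x : LocalRing L v // conjLocal L (IsCMField.complexConj L) v x * x = 1},
      IsUnit (1 - e.1) → IsUnit (1 - uE 1) → IsUnit (e.1 - uE 1) → IsLocalGRegular L v (Θ e) := by
    intro e h1e h1u heu
    change IsRegularElt ((endoEmbLocal L v (Θ e)).val : GL (Fin 3) (LocalRing L v))
    rw [isRegularElt_iff]
    change (((endoEmbLocal L v (Θ e)).val.val : Matrix (Fin 3) (Fin 3) (LocalRing L v))).charpoly.Separable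
    rw [charpoly_endoEmbLocal, finCharpolyTwo_eq_of_frame Q (hΘframe e), hΘsnd]
    exact ((Polynomial.separable_X_sub_C.mul Polynomial.separable_X_sub_C (Polynomial.isCoprime_X_sub_C_of_isUnit_sub h1e)).mul
      Polynomial.separable_X_sub_C
      (IsCoprime.mul_left (Polynomial.isCoprime_X_sub_C_of_isUnit_sub h1u) (Polynomial.isCoprime_X_sub_C_of_isUnit_sub heu)))
  -- the elements of the sequence as norm-one points
  let xX : ℕ → {x : LocalRing L v // conjLocal L (IsCMField.complexConj L) v x * x = 1} := fun N => ⟨uE N, huE1 N⟩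
  have x1 : conjLocal L (IsCMField.complexConj L) v (1 : LocalRing L v) * 1 = 1 := by rw [map_one, mul_one]
  have hxX : Tendsto xX atTop (𝓝 ⟨1, x1⟩) := by
    rw [tendsto_subtype_rng]
    change Tendsto uE atTop (𝓝 (1 : LocalRing L v))
    refine tendsto_pi_nhds.2 fun w' => ?_
    obtain rfl : w = w' := Subsingleton.elim w w'
    simp only [Pi.one_apply]
    exact hut.congr fun N => (huEw N).symm
  have hreg : ∀ N, 2 ≤ N → IsLocalGRegular L v (Θ (xX N)) := by
    intro N hN
    refine hΘreg (xX N) (hunit _ ?_) (hunit _ ?_) (hunit _ ?_)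
    · change (1 - uE N) w ≠ 0
      rw [Pi.sub_apply, Pi.one_apply, huEw]; exact hu_ne_one N (by omega)
    · rw [Pi.sub_apply, Pi.one_apply, huEw]; exact hu_ne_one 1 le_rfl
    · change (uE N - uE 1) w ≠ 0
      rw [Pi.sub_apply, huEw, huEw]; exact hu_ne 1 N le_rfl (by omega)
  -- §5 the torus `C := Z(t₀)`, `t₀ := t(u₂)`; every `t(e)` lies in it
  have hdiagcomm : ∀ a b : Fin 2 → LocalRing L v, Q.val * diagonal a * Q⁻¹.val * (Q.val * diagonal b * Q⁻¹.val) =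
      Q.val * diagonal b * Q⁻¹.val * (Q.val * diagonal a * Q⁻¹.val) := by
    intro a b
    have hab : diagonal a * diagonal b = diagonal b * diagonal a := by
      rw [diagonal_mul_diagonal, diagonal_mul_diagonal]; exact congrArg diagonal (funext fun i => mul_comm (a i) (b i))
    calc Q.val * diagonal a * Q⁻¹.val * (Q.val * diagonal b * Q⁻¹.val)
        = Q.val * (diagonal a * (Q⁻¹.val * Q.val) * diagonal b) * Q⁻¹.val := by simp only [Matrix.mul_assoc]
      _ = Q.val * (diagonal b * (Q⁻¹.val * Q.val) * diagonal a) * Q⁻¹.val := by rw [hQQ, Matrix.mul_one, Matrix.mul_one, hab]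
      _ = Q.val * diagonal b * Q⁻¹.val * (Q.val * diagonal a * Q⁻¹.val) := by simp only [Matrix.mul_assoc]
  have hmemC : ∀ e, Θ e ∈ Subgroup.centralizer ({Θ (xX 2)} : Set ((cmDatum L 2 (Matrix.of fun i j : Fin 2 => if i.val + j.val + 1 = 2 then (1 : L) else 0)).Local v ×
      (cmDatum L 1 (Matrix.of fun i j : Fin 1 => if i.val + j.val + 1 = 1 then (1 : L) else 0)).Local v)) := by
    intro e
    rw [Subgroup.mem_centralizer_singleton_iff]
    refine Prod.ext (Subtype.ext (Units.ext ?_)) rfl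
    exact hdiagcomm ![(1 : LocalRing L v), e.1] ![(1 : LocalRing L v), (xX 2).1]
  let ΘC : {x : LocalRing L v // conjLocal L (IsCMField.complexConj L) v x * x = 1} → ↥(Subgroup.centralizer ({Θ (xX 2)} : Set ((cmDatum L 2 (Matrix.of fun i j : Fin 2 => if i.val + j.val + 1 = 2 then (1 : L) else 0)).Local v ×
      (cmDatum L 1 (Matrix.of fun i j : Fin 1 => if i.val + j.val + 1 = 1 then (1 : L) else 0)).Local v))) :=
    fun e => ⟨Θ e, hmemC e⟩
  have hΘCc : Continuous ΘC := hΘc.subtype_mk _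
  -- §6 apply the letter
  obtain ⟨fC, hlc, -, hfC⟩ := hR L v hv (1 : HeckeCharacter L) ν mH (IsLocalGRegular L v) hReg1 hReg2 hmH _ hf (Θ (xX 2)) Q ![(1 : LocalRing L v), uE 2]
    (hReg1 _ (hreg 2 le_rfl)) (hΘframe (xX 2))

  -- §7 the left side along the sequence (FILE A) equals `f^C` there
  have hΦ₂h : ((Matrix.of fun i j : Fin 2 => if i.val + j.val + 1 = 2 then (1 : L) else 0).map (cmConjRingHom L))ᵀ =
      Matrix.of fun i j : Fin 2 => if i.val + j.val + 1 = 2 then (1 : L) else 0 := antidiagOne_isHermitian L 2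
  have hΦ₂d : (Matrix.of fun i j : Fin 2 => if i.val + j.val + 1 = 2 then (1 : L) else 0).det ≠ 0 := by
    rw [Matrix.det_fin_two]; simp [Matrix.of_apply]
  have hinj : ∀ N, 1 ≤ N → Function.Injective ![(1 : LocalRing L v), (xX N).1] := fun N hN =>
    injective_vecCons_pair fun h => hu_ne_one N hN (by
      have h' := congrFun h w
      rw [Pi.one_apply] at h'
      change (1 : w.1.adicCompletion L) = uE N w at h'
      rw [huEw] at h'
      rw [← h', sub_self])
  have hNv : ∀ N, 1 ≤ N → valuation (w.1.adicCompletion L) ((![(1 : LocalRing L v), (xX N).1] 0) w - (![(1 : LocalRing L v), (xX N).1] 1) w) =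
      valuation (w.1.adicCompletion L) ((toPlace v w (HeckeCharacter.uniformizer ↥(maximalRealSubfield L) v : v.adicCompletion ↥(maximalRealSubfield L))) ^ N) := by
    intro N hN
    have h0 : (![(1 : LocalRing L v), (xX N).1] 0) w = 1 := rfl
    have h1 : (![(1 : LocalRing L v), (xX N).1] 1) w = u N := huEw N
    rw [h0, h1]
    exact (v_eq_iff_valuation_eq _ _).1 (huv N hN)
  have hval : ∀ N, 2 ≤ N → ∃ e : ℕ, e ≤ 1 ∧
      (Even (WithZero.log (Valued.v ((twistGram (conjLocal L (IsCMField.complexConj L) v)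
        ((adelicForm L 2 (Matrix.of fun i j : Fin 2 => if i.val + j.val + 1 = 2 then (1 : L) else 0)).map (adeleToLocal L v)) Q.val 0 0) w))) ↔ e = 0) ∧
      fC (ΘC (xX N)) = ((Real.sqrt (∏ w' : PlacesOver L v, ‖(![(1 : LocalRing L v), (xX N).1] 0 - ![(1 : LocalRing L v), (xX N).1] 1) w'‖) : ℝ) : ℂ) *
        ((-1 : ℂ) ^ e * ((-1 : ℂ) ^ N * (Nat.card (𝓞 ↥(maximalRealSubfield L) ⧸ v.asIdeal) : ℂ) ^ N)) := by
    intro N hN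
    haveI : CompactSpace (Subgroup.centralizer ({(Θ (xX N)).1} : Set ((cmDatum L 2 (Matrix.of fun i j : Fin 2 => if i.val + j.val + 1 = 2 then (1 : L) else 0)).Local v))) :=
      compactSpace_centralizer_of_eigenframe_of_smul_eq L w hw _ hΦ₂h hΦ₂d (Θ (xX N)).1 (hΘframe (xX N)) (hinj N (by omega)) (hnorm (xX N))
    obtain ⟨e, he, hpar, hlhs⟩ := rankOne_lhs_indicator_one_eq_of_eigenframe L v w hw ν hunr hmH hνK (Θ (xX N)).1 (Θ (xX N)).2 (hreg N hN)
      (hΘframe (xX N)) (hinj N (by omega)) (hnorm (xX N)) (hNv N (by omega))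
    exact ⟨e, he, hpar, (hfC (ΘC (xX N)) (hreg N hN)).symm.trans hlhs⟩
  -- §8 `f^C` is locally constant at `t(1)`: eventually constant along the sequence
  have hev : ∀ᶠ N in atTop, fC (ΘC (xX N)) = fC (ΘC ⟨1, x1⟩) :=
    ((hΘCc.tendsto _).comp hxX).eventually_mem ((hlc.isOpen_fiber (fC (ΘC ⟨1, x1⟩))).mem_nhds rfl)
  obtain ⟨N₀, hN₀⟩ := eventually_atTop.1 hev
  obtain ⟨e, he, hpar, hN⟩ := hval (max N₀ 2) (le_max_right _ _)
  obtain ⟨e', he', hpar', hN1⟩ := hval (max N₀ 2 + 1) (by omega)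
  have hee : e' = e := by
    by_cases h0 : e = 0
    · rw [h0, hpar'.1 (hpar.2 h0)]
    · have h1 : e' ≠ 0 := fun h1 => h0 (hpar.1 (hpar'.2 h1))
      omega
  rw [hee] at hN1
  have hEq := (hN.symm.trans (hN₀ _ (le_max_left _ _))).trans ((hN₀ _ (by omega)).symm.trans hN1)
  -- §9 the sign clash: `a·s = −b·q·s` with `a > 0`, `b ≥ 0`, `s ≠ 0`
  set q : ℕ := Nat.card (𝓞 ↥(maximalRealSubfield L) ⧸ v.asIdeal) with hqdef
  have hq0 : (q : ℂ) ≠ 0 := by exact_mod_cast (show q ≠ 0 by have := two_le_natCard_quotient'' L v; omega)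
  set a : ℝ := Real.sqrt (∏ w' : PlacesOver L v, ‖(![(1 : LocalRing L v), (xX (max N₀ 2)).1] 0 - ![(1 : LocalRing L v), (xX (max N₀ 2)).1] 1) w'‖) with hadef
  set b : ℝ := Real.sqrt (∏ w' : PlacesOver L v, ‖(![(1 : LocalRing L v), (xX (max N₀ 2 + 1)).1] 0 - ![(1 : LocalRing L v), (xX (max N₀ 2 + 1)).1] 1) w'‖) with hbdef
  have ha : 0 < a := by
    refine Real.sqrt_pos.2 (Finset.prod_pos fun w' _ => norm_pos_iff.2 ?_)
    obtain rfl : w = w' := Subsingleton.elim w w'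
    rw [Pi.sub_apply]
    change (1 : w.1.adicCompletion L) - uE (max N₀ 2) w ≠ 0
    rw [huEw]
    exact hu_ne_one _ (by omega)
  have hb : 0 ≤ b := Real.sqrt_nonneg _
  have hs : ((-1 : ℂ) ^ e * ((-1 : ℂ) ^ (max N₀ 2) * (q : ℂ) ^ (max N₀ 2))) ≠ 0 :=
    mul_ne_zero (pow_ne_zero _ (by norm_num)) (mul_ne_zero (pow_ne_zero _ (by norm_num)) (pow_ne_zero _ hq0))
  have hsum : ((a : ℂ) + (b : ℂ) * (q : ℂ)) * ((-1 : ℂ) ^ e * ((-1 : ℂ) ^ (max N₀ 2) * (q : ℂ) ^ (max N₀ 2))) = 0 := by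
    rw [add_mul, hEq]
    ring
  have hab : (a : ℂ) + (b : ℂ) * (q : ℂ) = 0 := (mul_eq_zero.1 hsum).resolve_right hs
  have hab' : a + b * (q : ℝ) = 0 := by exact_mod_cast hab
  nlinarith [ha, hb, mul_nonneg hb (Nat.cast_nonneg q : (0 : ℝ) ≤ q)]

end Refutation

end Literature.NumberTheory.Rogawski1990

end
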